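import Mathlib
import Summits.ResolutionOfSingularities.ResolutionOfSingularities.Theorems.RadicialJungCleanModelsCleanProp44SectionPointRegular
import HarnessLib

/-!
# Route `RadicialJung`, crux `CleanModels` (stmt-ResolutionOfSingularities-15917), line `Sketch` rev 35, stub 6 `stub_cleanProp44` (X44c):
# THE DESCENT AT A BIRTH WITH STALK-NATURAL INPUTS ONLY — no localization facts: an r.s.p. `(P(u), t̄ + λ(u))` of `𝒪_{E,c′}` through `κ(c)[u][T]` and residue surjectivity

Seat decomp-res-hand-2 g21 (structural hand); sequel of ✓ `…SectionPoint` / ✓ `…SectionPointRegular`.  Those discharge the transfer hypotheses of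
✓ `descent_at_birth` from the three `IsLocalization.AtPrime` facts of `S = 𝒪_{E,c′}` at `𝔫₀ = (P, T + λ)` — i.e. from the chart identification
`E ∩ chart ≅ 𝔸²_{κ(c)}` (census (S2), L-sized).  THIS FILE removes the localization facts: the hands' scheme files work with regular systems of parameters at
points (g18–g20), and what they naturally hold at a birth `c′ ∈ Γ″ ⊂ E` is (i) a ring map `Λ : κ(c)[u][T] → 𝒪_{E,c′}` (constants = residues of `𝒪_{X,c}`, `u ↦ ū₂′`,
`T ↦ t̄_δ` — an `eval₂`-map, since `𝔪_c 𝒪_{X_δ,c′} ⊆ (u₁)`), (ii) `𝔫_{E,c′} = (Λ P, Λ(T + λ))` (an r.s.p.), (iii) every residue class of `𝒪_{E,c′}` is a polynomial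
in `u` (`κ(c′) = κ(P)`: `c′` is a point of the SECTION `Γ″ ≅ Z_{δ−2} ≅ ℙ¹`).  From (i)–(iii):

* `span_pair_eq_ker_evalQuot` / `isMaximal_span_pair` — `𝔫₀ = (P, T + λ)` is the kernel of `κ[u][T] → κ[u]/(P)`, `T ↦ −λ`, hence MAXIMAL;
  `comap_maximalIdeal_eq_span_pair` — so `Λ⁻¹(𝔫_S) = 𝔫₀` is AUTOMATIC from (ii) (hypothesis `hcomap` of ✓ `…SectionPoint…` discharged).
* `maximalIdeal_quotient_eq_span_of_newLeaf_of_res` / `newLeaf_not_mem_sq_of_res` / `isDiscreteValuationRing_quotient_newLeaf_of_res` — the (unif) / regularity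
  statements of ✓ `…SectionPoint(Regular)` with the fraction hypothesis `hsurj` replaced by the residue surjectivity (iii).
* `descent_at_birth_intrinsic` — **THE DESCENT AT ONE BIRTH from (i)–(iii) + `hli`/`dim 2` + `w ∈ 𝔫` + the surrogate along `K`** — the form the termination author can feed
  from r.s.p. bookkeeping alone.
* `pow_dvd_of_map_mem_maximalIdeal_pow_of_comap` — the (S3) analogue at the generic point `η″` of `Γ″`: for ANY ring map `ρ : R → D` into a DVR with `𝔫_D = (ρ π)` and
  `ρ⁻¹(𝔫_D) = (π)`: `ρ(Φ) ∈ 𝔫_D^n ⟹ π^n ∣ Φ` (replaces the `IsLocalization.AtPrime` hypothesis of ✓ `pow_dvd_of_mem_maximalIdeal_pow_atPrime`).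

Honest framing: OURS, elementary; producing `Λ`, the r.s.p. and `κ(c′) = κ(P)` from the tree's blowings up is what remains of (S2) at the births; nothing here proves X44c,
any case of `CleanModels`, or resolution of singularities in characteristic `p`. [cite: Matsumura1987, Thm. 14.2, Thm. 11.1–11.2; §8] [cite: CossartPiltant2008, Prop. 4.4 (proof, p. 11)]
-/

noncomputable section

set_option linter.dupNamespace false -- mandated namespace of this single-conjunct summit

open Polynomial IsLocalRing Literature.AlgebraicGeometry.Resolution

namespace Summit.ResolutionOfSingularities.ResolutionOfSingularities.Theorems.RadicialJung.CleanModels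

/-! ## §1 `𝔫₀ = (P, T + λ)` is maximal -/

section Maximal

variable {k : Type*} [Field k] (P lam : k[X])

/-- `𝔫₀ = (P, T + λ)` is the kernel of the evaluation `κ[u][T] → κ[u]/(P)`, `T ↦ −λ`. [folklore] -/
theorem span_pair_eq_ker_evalQuot :
    Ideal.span ({C P, X + C lam} : Set (k[X])[X]) =
      RingHom.ker ((Ideal.Quotient.mk (Ideal.span {P})).comp (evalRingHom (-lam))) := by
  apply le_antisymm
  · rw [Ideal.span_le, Set.insert_subset_iff, Set.singleton_subset_iff]
    refine ⟨?_, ?_⟩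
    · rw [SetLike.mem_coe, RingHom.mem_ker, RingHom.comp_apply, coe_evalRingHom, eval_C, Ideal.Quotient.eq_zero_iff_mem]
      exact Ideal.mem_span_singleton_self P
    · rw [SetLike.mem_coe, RingHom.mem_ker, RingHom.comp_apply, coe_evalRingHom]
      simp
  · intro f hf
    rw [RingHom.mem_ker, RingHom.comp_apply, coe_evalRingHom, Ideal.Quotient.eq_zero_iff_mem] at hf
    have h1 : f = (f - C (f.eval (-lam))) + C (f.eval (-lam)) := by ring
    rw [h1]
    refine Ideal.add_mem _ (sub_C_eval_mem_span_pair P lam f) ?_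
    obtain ⟨q, hq⟩ := Ideal.mem_span_singleton'.mp hf
    rw [← hq, C_mul]
    exact Ideal.mul_mem_left _ _ (Ideal.subset_span (by simp))

/-- **`𝔫₀ = (P, T + λ)` is a maximal ideal of `κ[u][T]`** (`P` prime: the quotient is the field `κ[u]/(P)`). [folklore] -/
theorem isMaximal_span_pair (hP : Prime P) : (Ideal.span ({C P, X + C lam} : Set (k[X])[X])).IsMaximal := by
  haveI : (Ideal.span {P}).IsPrime := (Ideal.span_singleton_prime hP.ne_zero).mpr hP
  haveI hmax : (Ideal.span {P}).IsMaximal :=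
    IsPrime.to_maximal_ideal (by rw [Ne, Ideal.span_singleton_eq_bot]; exact hP.ne_zero)
  letI := Ideal.Quotient.field (Ideal.span {P})
  rw [span_pair_eq_ker_evalQuot P lam]
  refine RingHom.ker_isMaximal_of_surjective _ fun y => ?_
  obtain ⟨g, rfl⟩ := Ideal.Quotient.mk_surjective y
  exact ⟨C g, by simp⟩

variable {S : Type*} [CommRing S] [Algebra (k[X])[X] S] [IsLocalRing S]

/-- **`Λ⁻¹(𝔫_S) = 𝔫₀` is automatic**: if `𝔫₀ S ⊆ 𝔫_S` then the contraction of `𝔫_S` is `𝔫₀` (a proper ideal containing a maximal one). [folklore] -/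
theorem comap_maximalIdeal_eq_span_pair (hP : Prime P)
    (h𝔫 : (Ideal.span ({C P, X + C lam} : Set (k[X])[X])).map (algebraMap (k[X])[X] S) ≤ maximalIdeal S) :
    (maximalIdeal S).comap (algebraMap (k[X])[X] S) = Ideal.span ({C P, X + C lam} : Set (k[X])[X]) := by
  have hle : Ideal.span ({C P, X + C lam} : Set (k[X])[X]) ≤ (maximalIdeal S).comap (algebraMap (k[X])[X] S) :=
    Ideal.map_le_iff_le_comap.mp h𝔫
  exact ((isMaximal_span_pair P lam hP).eq_of_le (Ideal.IsPrime.ne_top inferInstance) hle).symm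

end Maximal

/-! ## §2 (unif) and regularity of `K` from residue surjectivity -/

section Res

variable {k : Type*} [Field k] (P lam : k[X]) {S : Type*} [CommRing S] [Algebra (k[X])[X] S]

/-- **The congruence of the new leaf from residue surjectivity**: with `𝔫₀S ⊆ 𝔫_S`, every element of `S` a polynomial in `u` modulo `𝔫_S`, characteristic `p`, and
`w = v(c)·T − G^p ∈ 𝔫_S`: `v(c)·(T + λ) = w + P·h₁(u) + n₂`, `n₂ ∈ 𝔫_S²`. [folklore] -/
theorem exists_newLeaf_congr_of_res [IsLocalRing S] (p : ℕ) [hp : Fact p.Prime] [CharP S p] (hP : Prime P)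
    (h𝔫 : (Ideal.span ({C P, X + C lam} : Set (k[X])[X])).map (algebraMap (k[X])[X] S) ≤ maximalIdeal S)
    (hres : ∀ z : S, ∃ g : k[X], z - algebraMap (k[X])[X] S (C g) ∈ maximalIdeal S)
    (a₀ : k) {G : S} (hw𝔫 : algebraMap (k[X])[X] S (C (C a₀) * X) - G ^ p ∈ maximalIdeal S) :
    ∃ (h₁ : k[X]) (n₂ : S), n₂ ∈ maximalIdeal S ^ 2 ∧
      algebraMap (k[X])[X] S (C (C a₀)) * algebraMap (k[X])[X] S (X + C lam) =
        (algebraMap (k[X])[X] S (C (C a₀) * X) - G ^ p) + algebraMap (k[X])[X] S (C P) * algebraMap (k[X])[X] S (C h₁) + n₂ := by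
  set ι := algebraMap (k[X])[X] S with hι
  have hcomap := (comap_maximalIdeal_eq_span_pair P lam hP h𝔫).le
  have hy𝔫 : ι (X + C lam) ∈ maximalIdeal S := h𝔫 (Ideal.mem_map_of_mem _ (Ideal.subset_span (by simp)))
  obtain ⟨g₀, hg₀⟩ := hres G
  have hp1 : p = (p - 2) + 2 := (Nat.sub_add_cancel hp.out.two_le).symm
  have hGp : G ^ p - ι (C (g₀ ^ p)) ∈ maximalIdeal S ^ 2 := by
    rw [map_pow, map_pow, ← sub_pow_char G (ι (C g₀)), hp1, pow_add]
    exact Ideal.mul_mem_left _ _ (Ideal.pow_mem_pow hg₀ 2)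
  set h := C a₀ * lam + g₀ ^ p with hh
  have hιh : ι (C h) = (ι (C (C a₀)) * ι (X + C lam) - (ι (C (C a₀) * X) - G ^ p)) - (G ^ p - ι (C (g₀ ^ p))) := by
    simp only [hh, map_add, map_mul]
    ring
  have hιh𝔫 : ι (C h) ∈ maximalIdeal S := by
    rw [hιh]
    exact Ideal.sub_mem _ (Ideal.sub_mem _ (Ideal.mul_mem_left _ _ hy𝔫) hw𝔫) (Ideal.pow_le_self two_ne_zero hGp)
  have hhP : h ∈ Ideal.span {P} := by
    have h1 : C h ∈ Ideal.span ({C P, X + C lam} : Set (k[X])[X]) := hcomap (by rw [Ideal.mem_comap]; exact hιh𝔫)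
    have h2 := eval_mem_span_of_mem_span_pair P lam h1
    rwa [eval_C] at h2
  obtain ⟨h₁, hh₁⟩ := Ideal.mem_span_singleton'.mp hhP
  refine ⟨h₁, G ^ p - ι (C (g₀ ^ p)), hGp, ?_⟩
  have h3 : ι (C P) * ι (C h₁) = ι (C h) := by rw [← map_mul, ← map_mul, ← hh₁, mul_comm]
  rw [h3, hιh]; ring

/-- **(unif) from residue surjectivity**: `𝔫_S = 𝔫₀S`, `I ∋ w = v(c)T − G^p` (`v(c) ≠ 0`), `I ≤ 𝔫_S`, `S/I` a DVR, `S` Noetherian of characteristic `p` ⟹ `𝔫_{S/I} = (P̄)`.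
[cite: Matsumura1987, §8 (Nakayama)] -/
theorem maximalIdeal_quotient_eq_span_of_newLeaf_of_res [IsLocalRing S] [IsNoetherianRing S] (p : ℕ) [Fact p.Prime] [CharP S p]
    (hP : Prime P)
    (h𝔫eq : maximalIdeal S = (Ideal.span ({C P, X + C lam} : Set (k[X])[X])).map (algebraMap (k[X])[X] S))
    (hres : ∀ z : S, ∃ g : k[X], z - algebraMap (k[X])[X] S (C g) ∈ maximalIdeal S)
    (I : Ideal S) [I.IsPrime] [IsDiscreteValuationRing (S ⧸ I)] (hI : I ≤ maximalIdeal S) {a₀ : k} (ha₀ : a₀ ≠ 0) {G : S}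
    (hw : algebraMap (k[X])[X] S (C (C a₀) * X) - G ^ p ∈ I) :
    maximalIdeal (S ⧸ I) = Ideal.span {((Ideal.Quotient.mk I).comp ((algebraMap (k[X])[X] S).comp C)) P} := by
  set ι := algebraMap (k[X])[X] S with hι
  set x := ι (C P) with hx
  set yy := ι (X + C lam) with hyy
  have h𝔫xy : maximalIdeal S = Ideal.span ({x, yy} : Set S) := by
    rw [h𝔫eq, Ideal.map_span, Set.image_pair]
  have hx𝔫 : x ∈ maximalIdeal S := by rw [h𝔫xy]; exact Ideal.subset_span (by simp)
  obtain ⟨h₁, n₂, hn₂, hyeq⟩ := exists_newLeaf_congr_of_res P lam p hP h𝔫eq.symm.le hres a₀ (hI hw)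
  set mk := Ideal.Quotient.mk I with hmk
  have h𝔫bar : maximalIdeal (S ⧸ I) = (maximalIdeal S).map mk := (map_mk_eq_maximalIdeal_of_isMaximal I (maximalIdeal S) hI).symm
  have ha₀u : IsUnit (mk (ι (C (C a₀)))) := (((isUnit_iff_ne_zero.mpr ha₀).map C).map C).map ι |>.map mk
  have hybar : mk yy ∈ Ideal.span {mk x} ⊔ maximalIdeal (S ⧸ I) ^ 2 := by
    have h4 : mk (ι (C (C a₀))) * mk yy ∈ Ideal.span {mk x} ⊔ maximalIdeal (S ⧸ I) ^ 2 := by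
      rw [← map_mul, hyeq, map_add, map_add, Ideal.Quotient.eq_zero_iff_mem.mpr hw, zero_add, map_mul]
      refine Ideal.add_mem _ (Ideal.mem_sup_left (Ideal.mul_mem_right _ _ (Ideal.mem_span_singleton_self _))) ?_
      refine Ideal.mem_sup_right ?_
      rw [h𝔫bar, ← Ideal.map_pow]
      exact Ideal.mem_map_of_mem _ hn₂
    obtain ⟨u, hu⟩ := ha₀u
    have h5 : mk yy = ↑u⁻¹ * (mk (ι (C (C a₀))) * mk yy) := by rw [← hu, ← mul_assoc, Units.inv_mul, one_mul]
    rw [h5]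
    exact Ideal.mul_mem_left _ _ h4
  have hgen : maximalIdeal (S ⧸ I) = Ideal.span ({mk x, mk yy} : Set (S ⧸ I)) := by
    rw [h𝔫bar, h𝔫xy, Ideal.map_span, Set.image_pair]
  have hle : maximalIdeal (S ⧸ I) ≤ Ideal.span {mk x} ⊔ maximalIdeal (S ⧸ I) • maximalIdeal (S ⧸ I) := by
    rw [smul_eq_mul, ← pow_two]
    conv_lhs => rw [hgen]
    rw [Ideal.span_le, Set.insert_subset_iff, Set.singleton_subset_iff]
    exact ⟨Ideal.mem_sup_left (Ideal.mem_span_singleton_self _), hybar⟩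
  have hfg : (maximalIdeal (S ⧸ I)).FG := (isNoetherianRing_iff_ideal_fg _).mp inferInstance _
  have hnak := Submodule.le_of_le_smul_of_le_jacobson_bot hfg (maximalIdeal_le_jacobson ⊥) hle
  apply le_antisymm hnak
  rw [Ideal.span_singleton_le_iff_mem, h𝔫bar]
  exact Ideal.mem_map_of_mem _ hx𝔫

/-- **`w ∉ 𝔫_S²` from residue surjectivity** (`hli` for `(P, T + λ)`, `v(c) ≠ 0`). [cite: Matsumura1987, Thm. 14.2] -/
theorem newLeaf_not_mem_sq_of_res [IsLocalRing S] (p : ℕ) [Fact p.Prime] [CharP S p] (hP : Prime P)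
    (h𝔫 : (Ideal.span ({C P, X + C lam} : Set (k[X])[X])).map (algebraMap (k[X])[X] S) ≤ maximalIdeal S)
    (hres : ∀ z : S, ∃ g : k[X], z - algebraMap (k[X])[X] S (C g) ∈ maximalIdeal S)
    (hli : ∀ α β : S, α * algebraMap (k[X])[X] S (C P) + β * algebraMap (k[X])[X] S (X + C lam) ∈ maximalIdeal S ^ 2 →
      α ∈ maximalIdeal S ∧ β ∈ maximalIdeal S)
    {a₀ : k} (ha₀ : a₀ ≠ 0) {G : S} (hw𝔫 : algebraMap (k[X])[X] S (C (C a₀) * X) - G ^ p ∈ maximalIdeal S) :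
    algebraMap (k[X])[X] S (C (C a₀) * X) - G ^ p ∉ maximalIdeal S ^ 2 := by
  set ι := algebraMap (k[X])[X] S with hι
  intro hw2
  obtain ⟨h₁, n₂, hn₂, hcongr⟩ := exists_newLeaf_congr_of_res P lam p hP h𝔫 hres a₀ hw𝔫
  have h1 : (-ι (C h₁)) * ι (C P) + ι (C (C a₀)) * ι (X + C lam) ∈ maximalIdeal S ^ 2 := by
    have h2 : (-ι (C h₁)) * ι (C P) + ι (C (C a₀)) * ι (X + C lam) = (ι (C (C a₀) * X) - G ^ p) + n₂ := by
      rw [hcongr]; ring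
    rw [h2]
    exact Ideal.add_mem _ hw2 hn₂
  have hunit : IsUnit (ι (C (C a₀))) := (((isUnit_iff_ne_zero.mpr ha₀).map C).map C).map ι
  exact (IsLocalRing.mem_maximalIdeal _).mp (hli _ _ h1).2 hunit

variable [IsRegularLocalRing S]

/-- **`K = V(w)` regular at `c′` from residue surjectivity**: `(w)` is prime and `S/(w)` is a DVR (`dim S = 2`). [cite: Matsumura1987, Thm. 14.2, Thm. 11.2] -/
theorem isDiscreteValuationRing_quotient_newLeaf_of_res (p : ℕ) [Fact p.Prime] [CharP S p] (hP : Prime P)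
    (h𝔫 : (Ideal.span ({C P, X + C lam} : Set (k[X])[X])).map (algebraMap (k[X])[X] S) ≤ maximalIdeal S)
    (hres : ∀ z : S, ∃ g : k[X], z - algebraMap (k[X])[X] S (C g) ∈ maximalIdeal S)
    (hli : ∀ α β : S, α * algebraMap (k[X])[X] S (C P) + β * algebraMap (k[X])[X] S (X + C lam) ∈ maximalIdeal S ^ 2 →
      α ∈ maximalIdeal S ∧ β ∈ maximalIdeal S)
    (hdim : ringKrullDim S = 2) {a₀ : k} (ha₀ : a₀ ≠ 0) {G : S}
    (hw𝔫 : algebraMap (k[X])[X] S (C (C a₀) * X) - G ^ p ∈ maximalIdeal S) :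
    ∃ (_ : (Ideal.span {algebraMap (k[X])[X] S (C (C a₀) * X) - G ^ p}).IsPrime),
      IsDiscreteValuationRing (S ⧸ Ideal.span {algebraMap (k[X])[X] S (C (C a₀) * X) - G ^ p}) := by
  have hw2 := newLeaf_not_mem_sq_of_res P lam p hP h𝔫 hres hli ha₀ hw𝔫
  have hprime := IsRegularLocalRing.prime_of_not_mem_sq hw𝔫 hw2
  haveI hI : (Ideal.span {algebraMap (k[X])[X] S (C (C a₀) * X) - G ^ p}).IsPrime :=
    (Ideal.span_singleton_prime hprime.ne_zero).mpr hprime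
  obtain ⟨hreg, hdim'⟩ := IsRegularLocalRing.quotient_span_singleton hw𝔫 hw2
  haveI := hreg
  refine ⟨hI, isDiscreteValuationRing_of_isRegularLocalRing_of_ringKrullDim_eq_one _ ?_⟩
  obtain ⟨n, hn⟩ := exists_nat_cast_eq_ringKrullDim (R := S ⧸ Ideal.span {algebraMap (k[X])[X] S (C (C a₀) * X) - G ^ p})
  rw [hn, hdim] at hdim'
  rw [hn]
  have h1 : ((n + 1 : ℕ) : WithBot ℕ∞) = ((2 : ℕ) : WithBot ℕ∞) := by exact_mod_cast hdim'
  have h2 : n + 1 = 2 := by exact_mod_cast h1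
  have h3 : n = 1 := by omega
  subst h3
  rfl

/-- **THE DESCENT AT ONE BIRTH, STALK-NATURAL INPUTS** (memo 4e §2.5–2.6 «`δ*(c′) ≤ ν(c′)`» read on the base line): `S = 𝒪_{E,c′}` a regular local ring of
dimension `2` with a `κ(c)[u][T]`-algebra structure `Λ` such that `𝔫_S = (ΛP, Λ(T + λ))` (`P` a prime of `κ[u]`: the point of the base line under `c′`; `(P, T+λ)`
independent modulo `𝔫_S²` in `hli` form), every residue class of `S` a polynomial in `u` (`κ(c′) = κ(P)`), the new leaf `w = v(c)·T − G^p ∈ 𝔫_S` (`v(c) ≠ 0`) and the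
surrogate «`δ′ ≥ d′`» read along `K = V(w)` (`c(T + λ)^μ ∈ (w) + 𝔫_S^{μd′}`, ✓ `map_mem_sup_pow_of_le_leafSum_weight`) ⟹ some polynomial `g` has
`(−v(c))λ·1^p + (−g)^p ∈ (P)^{d′}` — the input format of ✓ `descent_le_sub_two` / ✓ `birth_descent_of_face`. [cite: CossartPiltant2008, Prop. 4.4 (proof, p. 11)] -/
theorem descent_at_birth_intrinsic (p : ℕ) [Fact p.Prime] [CharP k p] (hP : Prime P)
    (h𝔫eq : maximalIdeal S = (Ideal.span ({C P, X + C lam} : Set (k[X])[X])).map (algebraMap (k[X])[X] S))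
    (hres : ∀ z : S, ∃ g : k[X], z - algebraMap (k[X])[X] S (C g) ∈ maximalIdeal S)
    (hli : ∀ α β : S, α * algebraMap (k[X])[X] S (C P) + β * algebraMap (k[X])[X] S (X + C lam) ∈ maximalIdeal S ^ 2 →
      α ∈ maximalIdeal S ∧ β ∈ maximalIdeal S)
    (hdim : ringKrullDim S = 2) {c : k} (hc : c ≠ 0) {a₀ : k} (ha₀ : a₀ ≠ 0) {μ d' : ℕ} (hμ : 0 < μ) {G : S}
    (hw𝔫 : algebraMap (k[X])[X] S (C (C a₀) * X) - G ^ p ∈ maximalIdeal S)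
    (hf : algebraMap (k[X])[X] S (C (C c) * (X + C lam) ^ μ) ∈
      Ideal.span {algebraMap (k[X])[X] S (C (C a₀) * X) - G ^ p} ⊔ maximalIdeal S ^ (μ * d')) :
    ∃ g : k[X], C (-a₀) * lam * 1 ^ p + (-g) ^ p ∈ Ideal.span {P} ^ d' := by
  haveI : CharP S p := charP_of_algebra_polynomial (k := k) p
  obtain ⟨hI, hdvr⟩ := isDiscreteValuationRing_quotient_newLeaf_of_res P lam p hP h𝔫eq.symm.le hres hli hdim ha₀ hw𝔫
  haveI := hI
  haveI := hdvr
  set I := Ideal.span {algebraMap (k[X])[X] S (C (C a₀) * X) - G ^ p} with hIdef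
  haveI : CharP (S ⧸ I) p := charP_quotient_of_algebra_polynomial (k := k) p _
  have hIle : I ≤ maximalIdeal S := (Ideal.span_singleton_le_iff_mem _).mpr hw𝔫
  have hunif := maximalIdeal_quotient_eq_span_of_newLeaf_of_res P lam p hP h𝔫eq hres I hIle ha₀ (Ideal.mem_span_singleton_self _)
  have hresI : ∀ y : S ⧸ I, ∃ g : k[X],
      y - ((Ideal.Quotient.mk I).comp ((algebraMap (k[X])[X] S).comp C)) g ∈ maximalIdeal (S ⧸ I) := by
    intro y
    obtain ⟨z, rfl⟩ := Ideal.Quotient.mk_surjective y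
    obtain ⟨g, hg⟩ := hres z
    refine ⟨g, ?_⟩
    rw [← map_mk_eq_maximalIdeal_of_isMaximal I (maximalIdeal S) hIle, RingHom.comp_apply, RingHom.comp_apply, ← map_sub]
    exact Ideal.mem_map_of_mem _ hg
  exact descent_at_birth_of_unramified I (maximalIdeal S) hIle p hc a₀ lam hμ (Ideal.mem_span_singleton_self _) hf hP hunif hresI

end Res

/-! ## §3 The (S3) input at the generic point of `Γ″`, without localization facts -/

section GenericPoint

variable {R D : Type*} [CommRing R] [CommRing D] [IsDomain D] [IsDiscreteValuationRing D] (ρ : R →+* D) {π : R}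

/-- **`ρ(Φ) ∈ 𝔫_D^n ⟹ π^n ∣ Φ`** for a ring map `ρ : R → D` into a DVR with `𝔫_D = (ρ π)` (`π` uniformizes: `E → 𝔸²` unramified at `η″`) and `ρ⁻¹(𝔫_D) = (π)`
(`η″` is the generic point of the curve `V(π)`).  With `R = κ(c)[u][T]`, `D = 𝒪_{E,η″}` this is the hypothesis `hdvd` of ✓ `births_on_successor_le` /
✓ `tower_successor` from «the transform keeps order `μ` along `Γ″`». [cite: Matsumura1987, Thm. 11.1] -/
theorem pow_dvd_of_map_mem_maximalIdeal_pow_of_comap (hunif : maximalIdeal D = Ideal.span {ρ π})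
    (hcomap : (maximalIdeal D).comap ρ = Ideal.span {π}) :
    ∀ (n : ℕ) (Φ : R), ρ Φ ∈ maximalIdeal D ^ n → π ^ n ∣ Φ := by
  have hπ0 : ρ π ≠ 0 := by
    intro h0
    apply IsDiscreteValuationRing.not_a_field D
    rw [hunif, h0, Ideal.span_singleton_eq_bot]
  intro n
  induction n with
  | zero => intro Φ _; simp
  | succ n ih =>
    intro Φ hΦ
    obtain ⟨Φ₁, rfl⟩ := ih Φ (Ideal.pow_le_pow_right (Nat.le_succ n) hΦ)
    rw [hunif, Ideal.span_singleton_pow, Ideal.mem_span_singleton, map_mul, map_pow, pow_succ] at hΦ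
    obtain ⟨y, hy⟩ := hΦ
    have h2 : ρ Φ₁ = ρ π * y := by
      have h3 : ρ π ^ n * ρ Φ₁ = ρ π ^ n * (ρ π * y) := by rw [hy, mul_assoc]
      exact mul_left_cancel₀ (pow_ne_zero n hπ0) h3
    have h4 : Φ₁ ∈ (maximalIdeal D).comap ρ := by
      rw [Ideal.mem_comap, hunif, Ideal.mem_span_singleton]; exact ⟨y, h2⟩
    rw [hcomap, Ideal.mem_span_singleton] at h4
    obtain ⟨Φ₂, rfl⟩ := h4
    rw [pow_succ]
    exact mul_dvd_mul_left _ (dvd_mul_right π Φ₂)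

end GenericPoint

end Summit.ResolutionOfSingularities.ResolutionOfSingularities.Theorems.RadicialJung.CleanModels

end
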